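import Summits.BirchSwinnertonDyer.BirchSwinnertonDyer.Theorems.PrintCf2DisegniPairTwoQuotientLawValuation
import Literature.NumberTheory.EllipticCurves.PAdicLFunctionQuadraticTwistBirchPeriodProofs
import Literature.NumberTheory.EllipticCurves.PAdicLFunctionTameMultCongruenceAtTwoProofs
import Literature.NumberTheory.EllipticCurves.PAdicPowerSeriesDerivativeEvalProofs
import Literature.NumberTheory.EllipticCurves.PAdicBSDMemIwasawaRatProofs
import HarnessLib

/-!
# Road (C) `disegni-pair-two` on crux stmt-BirchSwinnertonDyer-20368 — BIRCH TRANSPORT on the `2`-adic side: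
# the branch function of the good curve `V = E^{(d)}` is `c · (1+T)^{−ℓ} ·` (the TAME `χ_d`-twisted `2`-adic
# `L`-function of the BASE curve `E`), with the SAME constant `c` that carries the period identity
# `c²·d·(Ω⁺_{f_V})² = (Ω⁺_{f_E})²`; and its derivative at the conductor-`8` point transports accordingly

Cell `bsd-print-cf2`, width seat `bsd-line-cf2-p1-w8` g24. `--supports stmt-BirchSwinnertonDyer-20368` (helper).
THEOREMS ONLY (no `def`, no named fact, no `sorry`); conditional on every displayed hypothesis (modularity
`exists_isNewformOf` is the displayed named fact of the tree's Birch lemma). BSD is not proved by any of this; no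
summit statement is claimed; 20368 is not closed here.

## Why (the class "constant" `v₂(ϖ(V))` is an artefact of `f_V`-currency)

`defectKey_chi8_modulo_descent_min` (`…TwistScaling.lean`) reads the `χ₈`-class defect key of a member `W` over its
good curve `V` in the currency of the newform `f_V` OF `V`: the `2`-adic object is `D_V = L₂′(f_V, α_V; −2)` and the
archimedean price is the plus period ratio `ϖ_V·Ω(V) = Ω⁺_{f_V}` (Manin constant / lattice index of the optimal curve
of the class of `V` — NOT class-uniform in print: Stein–Watkins, Byeon–Yhee, Acta Arith. 158 (2013)). For the crux,
`V` runs over the quadratic twists `E^{(d)}` of ONE base curve (`E = cm7`), and Birch's lemma (Mazur–Tate–Teitelbaum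
§I.8; tree `exists_ratPlusSymbol_twist_eq_sum_and_sq`, `padicLFunction_twist_eq_of_birch`) supplies ONE rational
`c ≠ 0` with BOTH `L₂(f_V, α_V, T) = C(c)·(1+T)^{−ℓ_m}·L₂(f_E, m, α_E, χ_d, T)` (tame `χ_d`-twisted function of the
FIXED form `f_E`, `m = d`) AND `c²·d·(Ω⁺_{f_V})² = (Ω⁺_{f_E})²`. With Pal's `√d·Ω(V) = |u₀|·Ω(E)` the constant `c`
CANCELS between the two sides (sequel `…TamePeriodTransport.lean`): no optimality input is needed.

## What is proved (base `E` arbitrary: globally minimal, good ordinary at `2`; `d > 0`, `d ≡ 1 (4)`, squarefree,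
`(d, N_E) = 1`; `V` a globally minimal model of `E^{(d)}`)

* §1 ★★ `exists_birchConstant_two` — `V` is ordinary at `2` and ONE `c ∈ ℚˣ` carries the `2`-adic identity and the
  squared period identity (the tree's two Birch theorems re-run on a single constant; `∃ x, [x]⁺_{f_V} ≠ 0` by
  `exists_ratPlusSymbol_ne_zero`).
* §2 ★★ `deriv_padicLFunction_twist_eq` — under the branch-point vanishing `L₂(f_V, α_V; −2) = 0`: the tame function
  `G = L₂(f_E, m, α_E, χ_d, ·)` ALSO vanishes at `−2`, and the derivative functionals satisfy
  `D_V = c · u · D_G` with `‖u‖₂ = 1` (`u = ev_{−2}((1+T)^{−ℓ_m})`, a unit by `PadicEval.norm_tsum_eval_binomialSeries`;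
  product rule at a zero, `PadicEval.tsum_deriv_mul_of_eval_eq_zero`); hence
  ★★ `valuation_deriv_padicLFunction_twist_eq`: `D_V ≠ 0 ↔ D_G ≠ 0` and `v₂(D_V) = v₂(c) + v₂(D_G)`.

References: B. Mazur, J. Tate, J. Teitelbaum, Invent. Math. 84 (1986) §I.8, §I.11–I.13 [MazurTateTeitelbaum1986Invent];
K. Matsuno, J. Number Theory 84 (2000) §2 [Matsuno2000]; V. Pal, Proc. AMS 140 (2012) Thm. 3.2 [Pal2012];
D. Byeon, D. Yhee, Acta Arith. 158 (2013) §1 (Stein–Watkins on optimal curves) [ByeonYhee2013].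
-/

set_option autoImplicit false
set_option linter.dupNamespace false

noncomputable section

open scoped Classical MatrixGroups ModularForm NumberField NumberTheorySymbols

open CongruenceSubgroup NumberField IsDedekindDomain WeierstrassCurve PowerSeries
  Literature.NumberTheory.EllipticCurves Literature.NumberTheory.EllipticCurves.ModularForms
  Literature.NumberTheory.EllipticCurves.GreenbergVatsal2000 Literature.NumberTheory.GaloisRepresentations
  Literature.NumberTheory.EllipticCurves.PadicEval

namespace Summit.BirchSwinnertonDyer.BirchSwinnertonDyer.Theorems.PrintCf2.DisegniPairTwo

section Transport

variable (E : WeierstrassCurve ℚ) [E.IsElliptic] [E.IsGloballyMinimal] {d : ℤ} {V : WeierstrassCurve ℚ}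
  [V.IsElliptic] [V.IsGloballyMinimal] [NeZero (E.conductorNorm ℤ)] [NeZero (V.conductorNorm ℤ)] [NeZero d.natAbs]
  {fE : CuspForm (Gamma0 (E.conductorNorm ℤ)) 2} {fV : CuspForm (Gamma0 (V.conductorNorm ℤ)) 2}

/-! ### §1 One Birch constant for both sides at `p = 2` -/

/-- ★★ **One Birch constant at `p = 2`, carrying BOTH identities.** For a globally minimal base `E/ℚ` good ordinary
at `2`, `d > 0` squarefree with `d ≡ 1 (mod 4)` and `(d, N_E) = 1`, a globally minimal model `V` of `E^{(d)}`
(`C₀ • E^{(d)} = V`) and the newforms `f_E`, `f_V`: `V` is good ordinary at `2`, and there is ONE `c ∈ ℚˣ` with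
(i) `L₂(f_V, α_V, T) = C(c)·(1+T)^{−ℓ_m}·L₂(f_E, m, α_E, χ_d, T)` (`m = d`, `χ_d = (·/m)`, tame twisted function of
`f_E`) and (ii) `c²·d·(Ω⁺_{f_V})² = (Ω⁺_{f_E})²`.
[cite: MazurTateTeitelbaum1986Invent, §I.8 and §I.11–I.13] [cite: Matsuno2000, §2 (p. 84)] -/
theorem exists_birchConstant_two (hmod : exists_isNewformOf) (hd : 0 < d) (hd4 : d % 4 = 1) (hsq : Squarefree d)
    (hcop : IsCoprime d (E.conductorNorm ℤ : ℤ)) {C₀ : VariableChange ℚ} (hV : C₀ • E.quadraticTwist (d : ℚ) = V)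
    (hfE : IsNewformOf E fE) (hfV : IsNewformOf V fV) (hord : IsOrdinaryAt E 2)
    {χ : MulChar (ZMod d.natAbs) ℤ} (hχ : ∀ a : ZMod d.natAbs, χ a = J((a.val : ℤ) | d.natAbs)) :
    IsOrdinaryAt V 2 ∧ ∃ c : ℚ, c ≠ 0 ∧
      padicLFunction fV (unitRoot V 2 : ℚ_[2]) =
        PowerSeries.C (c : ℚ_[2]) * PowerSeries.binomialSeries ℚ_[2] (-frobeniusExponent 2 (d.natAbs : ℤ_[2])) *
          padicLFunctionTame fE d.natAbs (unitRoot E 2 : ℚ_[2])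
            ((χ.ringHomComp (Int.castRingHom ℚ)).ringHomComp (Rat.castHom ℚ_[2])) ∧
      (c : ℝ) ^ 2 * (d : ℝ) * plusPeriod fV ^ 2 = plusPeriod fE ^ 2 := by
  have hp : (2 : ℕ).Prime := Nat.prime_two
  have hpd : ¬ ((2 : ℕ) : ℤ) ∣ d := by omega
  obtain ⟨c, hB, hper⟩ := exists_ratPlusSymbol_twist_eq_sum_and_sq E hmod hd hd4 hsq hcop hV hfE hfV hχ
  obtain ⟨hordV, hαV⟩ := isOrdinaryAt_twist_and_unitRoot_eq E 2 hmod hd4 hsq hcop hV hord hpd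
  obtain ⟨hαeq, hαu, -⟩ := unitRoot_coe_spec (W := E) hord
  have hpN : ¬ 2 ∣ E.conductorNorm ℤ := not_dvd_level_of_isNewformOf hfE hord.1
  have hpm : ¬ 2 ∣ d.natAbs := fun h ↦ hpd (Int.natCast_dvd.mpr h)
  have hmp : d.natAbs.Coprime 2 := Nat.coprime_comm.mp ((Nat.Prime.coprime_iff_not_dvd hp).mpr hpm)
  have hap : cuspCoeff fE 2 = ((E.frobeniusTrace 2 : ℤ) : ℂ) :=
    cuspCoeff_eq_frobeniusTrace_of_isNewformOf_holds hfE hord.1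
  have hχp : (χ.ringHomComp (Int.castRingHom ℚ)) ((2 : ℕ) : ZMod d.natAbs) ^ 2 = 1 := by
    rw [MulChar.ringHomComp_apply, ← map_pow, mulChar_jacobi_apply_natCast_sq hχ 2 hmp.symm, map_one]
  have key := padicLFunction_twist_eq_of_birch fE fV hfE.1 hfE.coeffField_eq_bot hpN hmp hap hαeq hαu
    (χ.ringHomComp (Int.castRingHom ℚ)) hχp hB
  have hαV' : (unitRoot V 2 : ℚ_[2]) =
      (((χ.ringHomComp (Int.castRingHom ℚ)) ((2 : ℕ) : ZMod d.natAbs) : ℚ) : ℚ_[2]) * (unitRoot E 2 : ℚ_[2]) := by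
    rw [hαV, MulChar.ringHomComp_apply, mulChar_jacobi_apply_natCast hχ 2, eq_intCast]
    push_cast
    rfl
  have hxV : ∃ x : ℚ, ratPlusSymbol fV x ≠ 0 := exists_ratPlusSymbol_ne_zero hfV.1 hfV.coeffField_eq_bot
  refine ⟨hordV, c, ?_, by rw [hαV']; exact key, hper hxV⟩
  rintro rfl
  have h0 := padicLFunction_unitRoot_ne_zero hordV hfV
  rw [hαV', key, Rat.cast_zero, map_zero, zero_mul, zero_mul] at h0
  exact h0 rfl

/-! ### §2 The derivative functional at the conductor-`8` point transports -/

/-- `‖−2‖₂ < 1`. [folklore] -/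
private theorem norm_neg_two_lt_one'' : ‖(-2 : ℚ_[2])‖ < 1 := by
  rw [norm_neg, show (2 : ℚ_[2]) = ((2 : ℕ) : ℚ_[2]) by norm_num, Padic.norm_p]
  norm_num

/-- **Inverting the Birch identity**: if `L = C(c)·(1+T)^{−ℓ}·G` with `c ≠ 0` then `G = C(c⁻¹)·(1+T)^{ℓ}·L`
(`(1+T)^{ℓ}(1+T)^{−ℓ} = 1`, `binomialSeries_add`); in particular `G` has bounded coefficients when `L` has.
[cite: MazurTateTeitelbaum1986Invent, §I.12] -/
theorem exists_norm_coeff_le_of_eq_C_mul_binomialSeries_mul {L G : PowerSeries ℚ_[2]} {c : ℚ_[2]} (hc : c ≠ 0)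
    (s : ℤ_[2]) (hL : L = PowerSeries.C c * PowerSeries.binomialSeries ℚ_[2] (-s) * G)
    {B : ℝ} (hB : ∀ k, ‖PowerSeries.coeff k L‖ ≤ B) : ∃ B' : ℝ, ∀ k, ‖PowerSeries.coeff k G‖ ≤ B' := by
  have hG : G = PowerSeries.C c⁻¹ * (PowerSeries.binomialSeries ℚ_[2] s * L) := by
    rw [hL]
    have h1 : PowerSeries.binomialSeries ℚ_[2] s * PowerSeries.binomialSeries ℚ_[2] (-s) = 1 := by
      rw [← binomialSeries_add, add_neg_cancel, binomialSeries_zero]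
    calc G = (PowerSeries.C c⁻¹ * PowerSeries.C c) *
          (PowerSeries.binomialSeries ℚ_[2] s * PowerSeries.binomialSeries ℚ_[2] (-s)) * G := by
            rw [h1, ← map_mul, inv_mul_cancel₀ hc, map_one, one_mul, one_mul]
      _ = PowerSeries.C c⁻¹ * (PowerSeries.binomialSeries ℚ_[2] s *
          (PowerSeries.C c * PowerSeries.binomialSeries ℚ_[2] (-s) * G)) := by ring
  refine ⟨‖c⁻¹‖ * (1 * B), fun k ↦ ?_⟩
  rw [hG]
  exact norm_coeff_C_mul_le (norm_coeff_mul_le (norm_coeff_binomialSeries_le_one s) hB) c⁻¹ k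

/-- ★★ **The derivative at the conductor-`8` point transports.** In the setting of `exists_birchConstant_two`, if the
branch function of `V` vanishes at `T = −2` (`Σ_k [T^k]L₂(f_V, α_V)·(−2)^k = 0`, the sign-forced zero of the
`χ₈`-class), then so does the tame function `G = L₂(f_E, m, α_E, χ_d, ·)`, and
`Σ_k k[T^k]L₂(f_V,α_V)(−2)^{k−1} = c · u · Σ_k k[T^k]G(−2)^{k−1}` with `‖u‖₂ = 1` (`u = ev_{−2}(1+T)^{−ℓ_m}`),
for the SAME `c` as the period identity `c²·d·(Ω⁺_{f_V})² = (Ω⁺_{f_E})²`.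
[cite: MazurTateTeitelbaum1986Invent, §I.8 and §I.13] [cite: Matsuno2000, §2 (p. 84)] -/
theorem deriv_padicLFunction_twist_eq (hmod : exists_isNewformOf) (hd : 0 < d) (hd4 : d % 4 = 1)
    (hsq : Squarefree d) (hcop : IsCoprime d (E.conductorNorm ℤ : ℤ)) {C₀ : VariableChange ℚ}
    (hV : C₀ • E.quadraticTwist (d : ℚ) = V) (hfE : IsNewformOf E fE) (hfV : IsNewformOf V fV)
    (hord : IsOrdinaryAt E 2) {χ : MulChar (ZMod d.natAbs) ℤ}
    (hχ : ∀ a : ZMod d.natAbs, χ a = J((a.val : ℤ) | d.natAbs))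
    (h0 : HasSum (fun k : ℕ ↦ PowerSeries.coeff k (padicLFunction fV (unitRoot V 2 : ℚ_[2])) *
      (-2 : ℚ_[2]) ^ k) 0) :
    ∃ c : ℚ, c ≠ 0 ∧ (c : ℝ) ^ 2 * (d : ℝ) * plusPeriod fV ^ 2 = plusPeriod fE ^ 2 ∧
      HasSum (fun k : ℕ ↦ PowerSeries.coeff k (padicLFunctionTame fE d.natAbs (unitRoot E 2 : ℚ_[2])
        ((χ.ringHomComp (Int.castRingHom ℚ)).ringHomComp (Rat.castHom ℚ_[2]))) * (-2 : ℚ_[2]) ^ k) 0 ∧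
      ∃ u : ℚ_[2], ‖u‖ = 1 ∧
        (∑' k : ℕ, PowerSeries.coeff k (padicLFunction fV (unitRoot V 2 : ℚ_[2])) * (k : ℚ_[2]) *
            (-2) ^ (k - 1)) =
          (c : ℚ_[2]) * u * ∑' k : ℕ, PowerSeries.coeff k (padicLFunctionTame fE d.natAbs (unitRoot E 2 : ℚ_[2])
            ((χ.ringHomComp (Int.castRingHom ℚ)).ringHomComp (Rat.castHom ℚ_[2]))) * (k : ℚ_[2]) *
              (-2) ^ (k - 1) := by
  obtain ⟨hordV, c, hc0, hkey, hper⟩ := exists_birchConstant_two E hmod hd hd4 hsq hcop hV hfE hfV hord hχ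
  set L := padicLFunction fV (unitRoot V 2 : ℚ_[2]) with hLdef
  set G := padicLFunctionTame fE d.natAbs (unitRoot E 2 : ℚ_[2])
    ((χ.ringHomComp (Int.castRingHom ℚ)).ringHomComp (Rat.castHom ℚ_[2])) with hGdef
  set s : ℤ_[2] := frobeniusExponent 2 (d.natAbs : ℤ_[2]) with hsdef
  set P := PowerSeries.binomialSeries ℚ_[2] (-s) with hPdef
  have hc0' : (c : ℚ_[2]) ≠ 0 := by exact_mod_cast hc0
  -- bounded coefficients: `L` (Mazur–Tate–Teitelbaum measure), `P` (binomial), `G` (by inversion)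
  obtain ⟨BL, hBL⟩ := exists_forall_norm_coeff_padicLFunction_le (f := fV) hordV hfV
  have hBP : ∀ k, ‖PowerSeries.coeff k P‖ ≤ 1 := norm_coeff_binomialSeries_le_one (-s)
  obtain ⟨BG, hBG⟩ := exists_norm_coeff_le_of_eq_C_mul_binomialSeries_mul hc0' s hkey hBL
  have ha := norm_neg_two_lt_one''
  -- evaluation: `0 = ev(L) = c · ev(P) · ev(G)`, `ev(P)` a unit ⇒ `ev(G) = 0`
  have hevL : ∑' k : ℕ, PowerSeries.coeff k L * (-2 : ℚ_[2]) ^ k = 0 := h0.tsum_eq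
  have hevPG : ∑' k : ℕ, PowerSeries.coeff k L * (-2 : ℚ_[2]) ^ k =
      (c : ℚ_[2]) * ((∑' k : ℕ, PowerSeries.coeff k P * (-2 : ℚ_[2]) ^ k) *
        ∑' k : ℕ, PowerSeries.coeff k G * (-2 : ℚ_[2]) ^ k) := by
    rw [hkey, mul_assoc, tsum_eval_C_mul, tsum_coeff_mul hBP hBG ha]
  have hu : ‖∑' k : ℕ, PowerSeries.coeff k P * (-2 : ℚ_[2]) ^ k‖ = 1 := norm_tsum_eval_binomialSeries (-s) ha
  have hP0 : ∑' k : ℕ, PowerSeries.coeff k P * (-2 : ℚ_[2]) ^ k ≠ 0 := tsum_eval_binomialSeries_ne_zero (-s) ha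
  have hevG : ∑' k : ℕ, PowerSeries.coeff k G * (-2 : ℚ_[2]) ^ k = 0 := by
    rw [hevL] at hevPG
    rcases mul_eq_zero.mp hevPG.symm with h | h
    · exact absurd h hc0'
    · rcases mul_eq_zero.mp h with h' | h'
      · exact absurd h' hP0
      · exact h'
  have hGsum : HasSum (fun k : ℕ ↦ PowerSeries.coeff k G * (-2 : ℚ_[2]) ^ k) 0 := by
    rw [← hevG]; exact (summable_of_norm_le hBG ha).hasSum
  -- derivative: product rule at the zero of `G`
  have hD : ∑' k : ℕ, PowerSeries.coeff k L * (k : ℚ_[2]) * (-2) ^ (k - 1) =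
      (c : ℚ_[2]) * (∑' k : ℕ, PowerSeries.coeff k P * (-2 : ℚ_[2]) ^ k) *
        ∑' k : ℕ, PowerSeries.coeff k G * (k : ℚ_[2]) * (-2) ^ (k - 1) := by
    rw [hkey, mul_assoc, tsum_deriv_C_mul, tsum_deriv_mul_of_eval_eq_zero hBP hBG ha hevG, mul_assoc]
  exact ⟨c, hc0, hper, hGsum, _, hu, hD⟩

/-- ★★ **Valuation form**: in the setting of `deriv_padicLFunction_twist_eq`, `D_V ≠ 0 ↔ D_G ≠ 0`, and when they are
non-zero `v₂(D_V) = v₂(c) + v₂(D_G)` — with the SAME `c` as in `c²·d·(Ω⁺_{f_V})² = (Ω⁺_{f_E})²`.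
[cite: MazurTateTeitelbaum1986Invent, §I.8 and §I.13] -/
theorem valuation_deriv_padicLFunction_twist_eq (hmod : exists_isNewformOf) (hd : 0 < d) (hd4 : d % 4 = 1)
    (hsq : Squarefree d) (hcop : IsCoprime d (E.conductorNorm ℤ : ℤ)) {C₀ : VariableChange ℚ}
    (hV : C₀ • E.quadraticTwist (d : ℚ) = V) (hfE : IsNewformOf E fE) (hfV : IsNewformOf V fV)
    (hord : IsOrdinaryAt E 2) {χ : MulChar (ZMod d.natAbs) ℤ}
    (hχ : ∀ a : ZMod d.natAbs, χ a = J((a.val : ℤ) | d.natAbs))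
    (h0 : HasSum (fun k : ℕ ↦ PowerSeries.coeff k (padicLFunction fV (unitRoot V 2 : ℚ_[2])) *
      (-2 : ℚ_[2]) ^ k) 0) :
    ∃ c : ℚ, c ≠ 0 ∧ (c : ℝ) ^ 2 * (d : ℝ) * plusPeriod fV ^ 2 = plusPeriod fE ^ 2 ∧
      HasSum (fun k : ℕ ↦ PowerSeries.coeff k (padicLFunctionTame fE d.natAbs (unitRoot E 2 : ℚ_[2])
        ((χ.ringHomComp (Int.castRingHom ℚ)).ringHomComp (Rat.castHom ℚ_[2]))) * (-2 : ℚ_[2]) ^ k) 0 ∧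
      ((∑' k : ℕ, PowerSeries.coeff k (padicLFunction fV (unitRoot V 2 : ℚ_[2])) * (k : ℚ_[2]) *
            (-2) ^ (k - 1)) ≠ 0 ↔
        (∑' k : ℕ, PowerSeries.coeff k (padicLFunctionTame fE d.natAbs (unitRoot E 2 : ℚ_[2])
            ((χ.ringHomComp (Int.castRingHom ℚ)).ringHomComp (Rat.castHom ℚ_[2]))) * (k : ℚ_[2]) *
              (-2) ^ (k - 1)) ≠ 0) ∧
      ((∑' k : ℕ, PowerSeries.coeff k (padicLFunctionTame fE d.natAbs (unitRoot E 2 : ℚ_[2])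
            ((χ.ringHomComp (Int.castRingHom ℚ)).ringHomComp (Rat.castHom ℚ_[2]))) * (k : ℚ_[2]) *
              (-2) ^ (k - 1)) ≠ 0 →
        (∑' k : ℕ, PowerSeries.coeff k (padicLFunction fV (unitRoot V 2 : ℚ_[2])) * (k : ℚ_[2]) *
            (-2) ^ (k - 1)).valuation =
          padicValRat 2 c + (∑' k : ℕ, PowerSeries.coeff k (padicLFunctionTame fE d.natAbs (unitRoot E 2 : ℚ_[2])
            ((χ.ringHomComp (Int.castRingHom ℚ)).ringHomComp (Rat.castHom ℚ_[2]))) * (k : ℚ_[2]) *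
              (-2) ^ (k - 1)).valuation) := by
  obtain ⟨c, hc0, hper, hGsum, u, hu, hD⟩ :=
    deriv_padicLFunction_twist_eq E hmod hd hd4 hsq hcop hV hfE hfV hord hχ h0
  have hc0' : (c : ℚ_[2]) ≠ 0 := by exact_mod_cast hc0
  have hu0 : u ≠ 0 := norm_pos_iff.mp (by rw [hu]; exact one_pos)
  have hvu : u.valuation = 0 := valuation_eq_of_norm_eq hu0 (n := 0) (by rw [hu]; simp)
  refine ⟨c, hc0, hper, hGsum, ?_, fun hG ↦ ?_⟩
  · rw [hD]
    refine ⟨fun h hG ↦ h (by rw [hG, mul_zero]), fun hG ↦ mul_ne_zero (mul_ne_zero hc0' hu0) hG⟩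
  · rw [hD, Padic.valuation_mul (mul_ne_zero hc0' hu0) hG, Padic.valuation_mul hc0' hu0, Padic.valuation_ratCast,
      hvu, add_zero]

end Transport

end Summit.BirchSwinnertonDyer.BirchSwinnertonDyer.Theorems.PrintCf2.DisegniPairTwo

end
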